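import Summits.Ventures.HodgeRepro2.T5QuotientPullback
import Mathlib.MeasureTheory.Group.Integral
import Mathlib.MeasureTheory.Integral.Prod
import Mathlib.MeasureTheory.Constructions.BorelSpace.Basic

/-!
# T5QuotientDescent — (A3) STEP 1: «L^{K_f} = L²(G(F)\G(𝔸)/K_f)», the descent half

Cell pub-hodge-repro2, seat p5, Tier 5 (route/T5-N4-p5.md, N4.3 (A3) STEP 1, l. 147).  The
converse of `T5QuotientPullback`: every `K`-invariant `L²`-class on `(X, μ)` is pulled back from
`L²(X/K, mk_*μ)`.  The device is the `K`-average `kAverage μK g x := ∫_K g(k • x) dμK` against a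
RIGHT-invariant probability measure `μK` on `K` (for `K = K_f` compact: its normalised Haar
measure): it is `K`-invariant EVERYWHERE (`kAverage_smul`, right invariance of `μK`), strongly
measurable (`stronglyMeasurable_kAverage`, Fubini's measurability), and equal to `g` almost
everywhere when `g` is `K`-invariant almost everywhere for each `k` (`kAverage_ae_eq`: by
Tonelli, for `μ`-a.e. `x` the integrand is `μK`-a.e. constant `= g x`).  The everywhere-invariant
average descends to the quotient (`descendAverage`, measurable for the quotient σ-algebra), lies in
`L²(mk_*μ)` because `∫ |h ∘ mk|² dμ = ∫ |h|² d(mk_*μ)`, and pulls back to the given class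
(`mem_range_pullback_of_mem_invariants`).  Hence

* `range_pullback_eq_invariants`: `range (pullback μ) = invariants μ` («L^{K_f}»), and
* `invariantsEquiv : L²(X/K, mk_*μ) ≃ₗᵢ[ℂ] invariants μ` — the identification
  «L^{K_f} = L²(G(F)\G(𝔸)/K_f)» as an isometry of Hilbert spaces, in the abstract form it has
  (a group `K` acting measurably and measure-preservingly on an s-finite `(X, μ)`, with a
  right-invariant probability measure on `K`).

Nothing about adeles, Haar measures on `G(𝔸)` or the `G_∞`-equivariance is asserted.  Mathlib only
besides rows 36 and 41.  Axioms: propext, Classical.choice, Quot.sound.  README §8(d): uses an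
L-value-free non-vanishing device: NO.
-/

namespace Summit.Ventures.HodgeRepro2.T5QuotientDescent

open MeasureTheory
open Summit.Ventures.HodgeRepro2.T5RegularRep Summit.Ventures.HodgeRepro2.T5QuotientPullback

variable {K X : Type*} [Group K] [MulAction K X] [MeasurableSpace K] [MeasurableSpace X]
  [MeasurableSMul₂ K X] (μK : Measure K) (μ : Measure X)

/-! ### The `K`-average -/

/-- The `K`-average `x ↦ ∫_K g(k • x) dμK` of a function on `X`. -/
noncomputable def kAverage (g : X → ℂ) (x : X) : ℂ := ∫ k, g (k • x) ∂μK

omit [MeasurableSpace X] [MeasurableSMul₂ K X] in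
/-- The `K`-average is `K`-invariant EVERYWHERE (right invariance of `μK`). -/
theorem kAverage_smul [MeasurableMul K] [μK.IsMulRightInvariant] (g : X → ℂ) (k₀ : K) (x : X) :
    kAverage μK g (k₀ • x) = kAverage μK g x := by
  unfold kAverage
  simp_rw [smul_smul]
  exact integral_mul_right_eq_self (fun k => g (k • x)) k₀

/-- The `K`-average of a measurable function is strongly measurable (Fubini's measurability). -/
theorem stronglyMeasurable_kAverage [SFinite μK] {g : X → ℂ} (hg : Measurable g) :
    StronglyMeasurable (kAverage μK g) := by
  have h : StronglyMeasurable (fun p : X × K => g (p.2 • p.1)) :=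
    (hg.comp (measurable_snd.smul measurable_fst)).stronglyMeasurable
  exact h.integral_prod_right'

/-- If `g` is `K`-invariant almost everywhere for every `k`, its `K`-average equals `g` almost
everywhere: by Tonelli, for `μ`-a.e. `x` the integrand `k ↦ g (k • x)` is `μK`-a.e. equal to the
constant `g x`. -/
theorem kAverage_ae_eq [SFinite μ] [SFinite μK] [IsProbabilityMeasure μK] {g : X → ℂ}
    (hg : Measurable g) (hinv : ∀ k : K, (fun x => g (k • x)) =ᵐ[μ] g) :
    kAverage μK g =ᵐ[μ] g := by
  have hmeas : MeasurableSet {p : K × X | g (p.1 • p.2) = g p.2} :=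
    measurableSet_eq_fun (hg.comp (measurable_fst.smul measurable_snd)) (hg.comp measurable_snd)
  have h1 : ∀ᵐ k ∂μK, ∀ᵐ x ∂μ, g (k • x) = g x := Filter.Eventually.of_forall hinv
  have h2 : ∀ᵐ x ∂μ, ∀ᵐ k ∂μK, g (k • x) = g x := (Measure.ae_ae_comm hmeas).1 h1
  filter_upwards [h2] with x hx
  calc kAverage μK g x = ∫ k, g (k • x) ∂μK := rfl
    _ = ∫ _, g x ∂μK := integral_congr_ae hx
    _ = g x := by simp

/-! ### Descent to the quotient -/

/-- The `K`-average descends to `X/K` (it is `K`-invariant everywhere). -/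
noncomputable def descendAverage [MeasurableMul K] [μK.IsMulRightInvariant] (g : X → ℂ)
    (q : MulAction.orbitRel.Quotient K X) : ℂ :=
  Quotient.liftOn' q (kAverage μK g) fun x y hxy => by
    obtain ⟨k, rfl⟩ := MulAction.mem_orbit_iff.1 (MulAction.orbitRel_apply.1 hxy)
    exact kAverage_smul μK g k y

omit [MeasurableSpace X] [MeasurableSMul₂ K X] in
/-- The descended function on a class. -/
theorem descendAverage_mk [MeasurableMul K] [μK.IsMulRightInvariant] (g : X → ℂ) (x : X) :
    descendAverage μK g (mk K x) = kAverage μK g x :=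
  rfl

/-- The descended function is measurable for the quotient σ-algebra. -/
theorem measurable_descendAverage [MeasurableMul K] [μK.IsMulRightInvariant] [SFinite μK]
    {g : X → ℂ} (hg : Measurable g) : Measurable (descendAverage μK g) :=
  measurable_from_quotient.2 (stronglyMeasurable_kAverage μK hg).measurable

/-! ### Every `K`-invariant `L²`-class comes from the quotient -/

section Invariants

variable [MeasurableMul K] [SFinite μ] [SFinite μK] [IsProbabilityMeasure μK]
  [μK.IsMulRightInvariant] [SMulInvariantMeasure K X μ]

include μK in
/-- **DESCENT.**  A `K`-invariant class `f ∈ L²(X, μ)` lies in the range of the pull-back from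
`L²(X/K, mk_*μ)`: take a strongly measurable representative `g`, its `K`-average (equal to `g`
a.e.), descend it, and pull back. -/
theorem mem_range_pullback_of_mem_invariants (f : Lp ℂ 2 μ) (hf : f ∈ invariants (K := K) μ) :
    f ∈ Set.range (pullback (K := K) μ) := by
  set g : X → ℂ := (Lp.aestronglyMeasurable f).mk f with hg_def
  have hg_ae : (f : X → ℂ) =ᵐ[μ] g := (Lp.aestronglyMeasurable f).ae_eq_mk
  have hg_meas : Measurable g := (Lp.aestronglyMeasurable f).stronglyMeasurable_mk.measurable
  have hinv : ∀ k : K, (fun x => g (k • x)) =ᵐ[μ] g := by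
    intro k
    have h1 : (f : X → ℂ) ∘ (fun x => k • x) =ᵐ[μ] f := by
      have h := coeFn_regularRep_apply μ k⁻¹ f
      rw [inv_inv, (mem_invariants_iff μ).1 hf k⁻¹] at h
      exact h.symm
    have h2 : (f : X → ℂ) ∘ (fun x => k • x) =ᵐ[μ] g ∘ (fun x => k • x) :=
      (measurePreserving_smul k μ).quasiMeasurePreserving.ae_eq_comp hg_ae
    exact h2.symm.trans (h1.trans hg_ae)
  have hav : kAverage μK g =ᵐ[μ] g := kAverage_ae_eq μK μ hg_meas hinv
  have hmem : MemLp (descendAverage μK g) 2 (quotMeasure (K := K) μ) := by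
    rw [memLp_map_measure_iff (measurable_descendAverage μK hg_meas).aestronglyMeasurable
      (measurable_mk (K := K) (X := X)).aemeasurable]
    exact (Lp.memLp f).ae_eq (hg_ae.trans hav.symm)
  refine Set.mem_range.2 ⟨hmem.toLp _, ?_⟩
  rw [pullback_toLp]
  apply Lp.ext
  refine (MemLp.coeFn_toLp _).trans ?_
  exact hav.trans hg_ae.symm

include μK in
/-- **«L^{K_f} = L²(G(F)\G(𝔸)/K_f)», as subspaces**: the range of the pull-back is exactly the
space of `K`-invariant vectors. -/
theorem range_pullback_eq_invariants :
    LinearMap.range (pullback (K := K) μ).toLinearMap = invariants (K := K) μ :=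
  le_antisymm (range_pullback_le_invariants μ) fun f hf => by
    obtain ⟨h, rfl⟩ := mem_range_pullback_of_mem_invariants μK μ f hf
    exact ⟨h, rfl⟩

include μK in
/-- **«L^{K_f} = L²(G(F)\G(𝔸)/K_f)», as Hilbert spaces**: the pull-back is a linear isometric
isomorphism of `L²(X/K, mk_*μ)` onto the `K`-invariants of `L²(X, μ)`. -/
noncomputable def invariantsEquiv :
    Lp ℂ 2 (quotMeasure (K := K) μ) ≃ₗᵢ[ℂ] invariants (K := K) μ :=
  (pullback μ).equivRange.trans (LinearIsometryEquiv.ofEq _ _ (range_pullback_eq_invariants μK μ))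

/-- The isomorphism is the pull-back on points. -/
theorem coe_invariantsEquiv_apply (h : Lp ℂ 2 (quotMeasure (K := K) μ)) :
    (invariantsEquiv μK μ h : Lp ℂ 2 μ) = pullback μ h :=
  rfl

end Invariants

end Summit.Ventures.HodgeRepro2.T5QuotientDescent
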